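import Summits.QuantumFields.YangMills.Theorems.ConvexGribovBodyCovarianceBoundDefs

/-!
# Stub `stub_supMeasurable` for the crux `CovarianceBound` (stmt-QuantumFields-8780), line `Sketch`

Route `QuantumFields/YangMills/ConvexGribovBody`, crux
`Summit.QuantumFields.YangMills.Theses.ConvexGribovBody.CovarianceBound`, skeleton line `Sketch`
(support slope × response window). This file proves the registered classical stub
`stub_supMeasurable` over the line's vocabulary
(`Theorems/ConvexGribovBodyCovarianceBoundDefs.lean`): on the torus `(2S+1)⁴`, for a compact group
`G` carrying a faithful continuous unitary matrix representation `r`,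

1. every configuration `U` has an absolute minimiser `h` of the slice Coulomb functional
   `coulombF r S U ·` (the gauge group `Site → G` is compact, `coulombF` is continuous);
2. the a-priori bounds `0 ≤ modeCov ≤ 3 N (2S+1)³` and
   `froSq (cosMode), froSq (sinMode) ≤ N (2S+1)⁶` (unitarity of `ρ`: `‖ρ(g)‖²_F = N`, so
   `‖A_j(y)‖_F ≤ √N`, and the triangle inequality over the `(2S+1)³` sites of the slice);
3. Borel measurability of the three sup-over-minimisers functionals `supCov`, `supCosSq`, `supSinSq`
   (Berge: the argmin graph `{(U, h) | IsCoulMin r S U h}` is closed in the compact product, hence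
   the fibrewise supremum of a jointly continuous bounded function is upper semicontinuous (tube
   lemma), and an upper semicontinuous real function on a second-countable product of Borel spaces
   is measurable; `G` is second countable through the closed embedding `ρ`);
4. the same bounds for the sups (`Real.iSup_le`, `Real.iSup_nonneg`).

Helper lemmas live in the sub-namespace `SupMeasurable`. No named facts are used.
-/

set_option autoImplicit false

noncomputable section

namespace Summit.QuantumFields.YangMills.Cruxes.CovarianceBound.SupportWindow

open scoped BigOperators Topology Manifold Classical MeasureTheory ProbabilityTheory Matrix
  InnerProductSpace ComplexConjugate ContinuousMap
open Filter Set Function TopologicalSpace MeasureTheory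
open Literature.MathematicalPhysics.QuantumFieldTheory

/-! ### Helper lemmas

They live in the sub-namespace `SupMeasurable` (no clash with the other stubs of the line). -/

namespace SupMeasurable

/-! #### A Berge-type measurability lemma -/

/-- **Berge upper semicontinuity, measurable form.** Let `Y` be compact, `K ⊆ X × Y` closed with
nonempty fibres `K_x = {y | K x y}`, and `f : X × Y → ℝ` jointly continuous and bounded above. Then
the fibrewise supremum `x ↦ sup_{y ∈ K_x} f (x, y)` is upper semicontinuous (tube lemma), hence
Borel measurable. Applied below with `K` = the graph of the absolute Coulomb minimisers.
[folklore] -/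
theorem measurable_iSup_subtype_of_isClosed {X Y : Type*} [TopologicalSpace X]
    [TopologicalSpace Y] [CompactSpace Y] [MeasurableSpace X] [OpensMeasurableSpace X]
    {K : X → Y → Prop} (hK : IsClosed {q : X × Y | K q.1 q.2}) (hne : ∀ x, ∃ y, K x y)
    {f : X → Y → ℝ} (hf : Continuous (uncurry f)) {B : ℝ} (hB : ∀ x y, f x y ≤ B) :
    Measurable fun x => ⨆ y : {y // K x y}, f x y.1 := by
  refine UpperSemicontinuous.measurable ?_
  intro x₀ t ht
  have hbdd : ∀ x, BddAbove (Set.range fun y : {y // K x y} => f x y.1) :=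
    fun x => ⟨B, by rintro _ ⟨y, rfl⟩; exact hB x y.1⟩
  obtain ⟨t', h1, h2⟩ := exists_between ht
  have hlt : ∀ y, K x₀ y → f x₀ y < t' := fun y hy =>
    lt_of_le_of_lt (le_ciSup (hbdd x₀) ⟨y, hy⟩) h1
  have hO : IsOpen {q : X × Y | K q.1 q.2 → f q.1 q.2 < t'} := by
    have : {q : X × Y | K q.1 q.2 → f q.1 q.2 < t'} =
        {q : X × Y | K q.1 q.2}ᶜ ∪ {q | uncurry f q < t'} := by
      ext q
      simp only [mem_setOf_eq, mem_union, mem_compl_iff, uncurry, imp_iff_not_or]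
    rw [this]
    exact hK.isOpen_compl.union (isOpen_lt hf continuous_const)
  have hev : ∀ y ∈ (univ : Set Y), ∀ᶠ q : X × Y in 𝓝 (x₀, y), K q.1 q.2 → f q.1 q.2 < t' :=
    fun y _ => hO.mem_nhds fun hy => hlt y hy
  filter_upwards [isCompact_univ.eventually_forall_of_forall_eventually
    (P := fun x y => K x y → f x y < t') hev] with x hx
  obtain ⟨y₀, hy₀⟩ := hne x
  haveI : Nonempty {y // K x y} := ⟨⟨y₀, hy₀⟩⟩
  exact lt_of_le_of_lt (ciSup_le fun y => (hx y.1 (mem_univ _) y.2).le) h2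

/-- **Minimisers exist** for a jointly continuous `c : X × Y → ℝ` with `Y` compact and nonempty:
every fibre `c(x, ·)` attains its infimum. [folklore] -/
theorem exists_forall_le_of_continuous {X Y : Type*} [TopologicalSpace X] [TopologicalSpace Y]
    [CompactSpace Y] [Nonempty Y] {c : X → Y → ℝ} (hc : Continuous (uncurry c)) (x : X) :
    ∃ y, ∀ y', c x y ≤ c x y' := by
  have h1 : Continuous fun y => c x y := hc.comp (Continuous.prodMk continuous_const continuous_id)
  obtain ⟨y₀, -, hmin⟩ := isCompact_univ.exists_isMinOn univ_nonempty h1.continuousOn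
  exact ⟨y₀, fun y' => hmin (mem_univ y')⟩

/-- **The argmin graph is closed**: for a jointly continuous `c`, the set of pairs `(x, y)` with
`y ∈ argmin c(x, ·)` is an intersection of closed sets `{c(x, y) ≤ c(x, y')}`. [folklore] -/
theorem isClosed_setOf_forall_le {X Y : Type*} [TopologicalSpace X] [TopologicalSpace Y]
    {c : X → Y → ℝ} (hc : Continuous (uncurry c)) :
    IsClosed {q : X × Y | ∀ y', c q.1 q.2 ≤ c q.1 y'} := by
  simp only [setOf_forall]
  exact isClosed_iInter fun y' =>
    isClosed_le hc (hc.comp (continuous_fst.prodMk continuous_const))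

/-! #### The squared Frobenius norm -/

/-- `froSq M ≥ 0`. [folklore] -/
theorem froSq_nonneg {N : ℕ} (M : Matrix (Fin N) (Fin N) ℂ) : 0 ≤ froSq M := by
  unfold froSq; positivity

/-- `froSq` is continuous. [folklore] -/
theorem continuous_froSq {N : ℕ} : Continuous (froSq : Matrix (Fin N) (Fin N) ℂ → ℝ) := by
  unfold froSq
  refine continuous_finsetSum _ fun a _ => continuous_finsetSum _ fun b _ => ?_
  exact (continuous_id.matrix_elem a b).norm.pow 2

/-- A unitary `N × N` matrix has squared Frobenius norm `N` (its rows are orthonormal).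
[folklore] -/
theorem froSq_of_mem_unitaryGroup {N : ℕ} {V : Matrix (Fin N) (Fin N) ℂ}
    (hV : V ∈ Matrix.unitaryGroup (Fin N) ℂ) : froSq V = N := by
  have hU : V * Vᴴ = 1 := by
    have := Matrix.mem_unitaryGroup_iff.1 hV
    rwa [Matrix.star_eq_conjTranspose] at this
  have hrow : ∀ a, ∑ b, ‖V a b‖ ^ 2 = 1 := by
    intro a
    have h := congrFun (congrFun hU a) a
    rw [Matrix.mul_apply, Matrix.one_apply_eq] at h
    simp only [Matrix.conjTranspose_apply, Complex.star_def, Complex.mul_conj'] at h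
    exact_mod_cast h
  unfold froSq
  simp [hrow]

section Frobenius

open scoped Matrix.Norms.Frobenius

/-- `froSq` is the square of Mathlib's Frobenius norm. [folklore] -/
theorem froSq_eq_norm_sq {N : ℕ} (M : Matrix (Fin N) (Fin N) ℂ) : froSq M = ‖M‖ ^ 2 := by
  have h0 : 0 ≤ ∑ i, ∑ j, ‖M i j‖ ^ (2 : ℝ) := by positivity
  rw [Matrix.frobenius_norm_def, ← Real.rpow_natCast, ← Real.rpow_mul h0]
  norm_num [froSq]

/-- The anti-Hermitian part does not increase the Frobenius norm:
`‖½(V - Vᴴ)‖_F ≤ ½(‖V‖_F + ‖Vᴴ‖_F) = ‖V‖_F`. [folklore] -/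
theorem froSq_half_sub_conjTranspose_le {N : ℕ} (V : Matrix (Fin N) (Fin N) ℂ) :
    froSq ((1 / 2 : ℂ) • (V - Vᴴ)) ≤ froSq V := by
  rw [froSq_eq_norm_sq, froSq_eq_norm_sq]
  have h2 : ‖(1 / 2 : ℂ)‖ = 1 / 2 := by norm_num
  have h : ‖(1 / 2 : ℂ) • (V - Vᴴ)‖ ≤ ‖V‖ := by
    rw [norm_smul, h2]
    calc 1 / 2 * ‖V - Vᴴ‖ ≤ 1 / 2 * (‖V‖ + ‖Vᴴ‖) :=
          mul_le_mul_of_nonneg_left (norm_sub_le _ _) (by norm_num)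
      _ = ‖V‖ := by rw [Matrix.frobenius_norm_conjTranspose]; ring
  exact pow_le_pow_left₀ (norm_nonneg _) h 2

/-- Triangle inequality in the Frobenius norm: if `‖c_i‖ ≤ 1` and `froSq (A i) ≤ B` on `s`, then
`froSq (Σ_{i ∈ s} c_i • A_i) ≤ (#s)² B`. [folklore] -/
theorem froSq_sum_smul_le {N : ℕ} {ι : Type*} (s : Finset ι) (c : ι → ℂ)
    (A : ι → Matrix (Fin N) (Fin N) ℂ) (hc : ∀ i ∈ s, ‖c i‖ ≤ 1) {B : ℝ} (hB0 : 0 ≤ B)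
    (hA : ∀ i ∈ s, froSq (A i) ≤ B) :
    froSq (∑ i ∈ s, c i • A i) ≤ (s.card : ℝ) ^ 2 * B := by
  rw [froSq_eq_norm_sq]
  have hAi : ∀ i ∈ s, ‖A i‖ ≤ Real.sqrt B := fun i hi =>
    Real.le_sqrt_of_sq_le (by rw [← froSq_eq_norm_sq]; exact hA i hi)
  have h1 : ‖∑ i ∈ s, c i • A i‖ ≤ s.card * Real.sqrt B := by
    calc ‖∑ i ∈ s, c i • A i‖ ≤ ∑ i ∈ s, ‖c i • A i‖ := norm_sum_le _ _
      _ ≤ ∑ i ∈ s, Real.sqrt B := Finset.sum_le_sum fun i hi => by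
          rw [norm_smul]
          calc ‖c i‖ * ‖A i‖ ≤ 1 * Real.sqrt B :=
                mul_le_mul (hc i hi) (hAi i hi) (norm_nonneg _) zero_le_one
            _ = Real.sqrt B := one_mul _
      _ = s.card * Real.sqrt B := by rw [Finset.sum_const, nsmul_eq_mul]
  calc ‖∑ i ∈ s, c i • A i‖ ^ 2 ≤ (s.card * Real.sqrt B) ^ 2 :=
        pow_le_pow_left₀ (norm_nonneg _) h1 2
    _ = (s.card : ℝ) ^ 2 * B := by rw [mul_pow, Real.sq_sqrt hB0]

end Frobenius

/-! #### Continuity of the slice functionals in `(U, h)` -/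

variable {G : Type} [Group G] [TopologicalSpace G]

/-- `(U, h) ↦ ρ((U^h)_e)` is continuous. [folklore] -/
theorem continuous_rho_gaugeTransform [IsTopologicalGroup G] (r : LatticeRep G) (S : ℕ)
    (e : Edge 4 (2 * S + 1)) :
    Continuous fun q : GaugeConfig 4 (2 * S + 1) G × (Site 4 (2 * S + 1) → G) =>
      r.ρ (gaugeTransform q.2 q.1 e) := by
  refine r.continuous.comp ?_
  simp only [gaugeTransform]
  fun_prop

/-- The slice Coulomb functional is jointly continuous in `(U, h)`. [folklore] -/
theorem continuous_coulombF [IsTopologicalGroup G] (r : LatticeRep G) (S : ℕ) :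
    Continuous fun q : GaugeConfig 4 (2 * S + 1) G × (Site 4 (2 * S + 1) → G) =>
      coulombF r S q.1 q.2 := by
  unfold coulombF
  refine Continuous.neg (continuous_finsetSum _ fun e _ => ?_)
  by_cases he : e.1 0 = 0 ∧ e.2 ≠ 0
  · simp only [if_pos he]
    exact Complex.continuous_re.comp (continuous_rho_gaugeTransform r S e).matrix_trace
  · simp only [if_neg he]
    exact continuous_const

/-- The gauge-fixed gluon field is jointly continuous in `(U, h)`. [folklore] -/
theorem continuous_gluon [IsTopologicalGroup G] (r : LatticeRep G) (S : ℕ)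
    (y : Fin 3 → ZMod (2 * S + 1)) (j : Fin 3) :
    Continuous fun q : GaugeConfig 4 (2 * S + 1) G × (Site 4 (2 * S + 1) → G) =>
      gluon r S q.1 q.2 y j := by
  unfold gluon
  exact ((continuous_rho_gaugeTransform r S _).fun_sub
    (continuous_rho_gaugeTransform r S _).matrix_conjTranspose).fun_const_smul (1 / 2 : ℂ)

/-- `(U, h) ↦ froSq (Σ_y c_y • A_j(y))` is continuous for fixed coefficients `c`. [folklore] -/
theorem continuous_froSq_sum_smul_gluon [IsTopologicalGroup G] (r : LatticeRep G) (S : ℕ)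
    (j : Fin 3) (c : (Fin 3 → ZMod (2 * S + 1)) → ℂ) :
    Continuous fun q : GaugeConfig 4 (2 * S + 1) G × (Site 4 (2 * S + 1) → G) =>
      froSq (∑ y, c y • gluon r S q.1 q.2 y j) :=
  continuous_froSq.comp
    (continuous_finsetSum _ fun y _ => (continuous_gluon r S y j).fun_const_smul (c y))

/-- The covariance integrand `modeCov` is jointly continuous in `(U, h)`. [folklore] -/
theorem continuous_modeCov [IsTopologicalGroup G] (r : LatticeRep G) (S : ℕ)
    (p : Fin 3 → ZMod (2 * S + 1)) :
    Continuous fun q : GaugeConfig 4 (2 * S + 1) G × (Site 4 (2 * S + 1) → G) =>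
      modeCov r S q.1 q.2 p := by
  unfold modeCov
  refine Continuous.div_const (continuous_finsetSum _ fun j _ => ?_) _
  exact continuous_froSq_sum_smul_gluon r S j _

/-- `froSq` of the cosine mode is jointly continuous in `(U, h)`. [folklore] -/
theorem continuous_froSq_cosMode [IsTopologicalGroup G] (r : LatticeRep G) (S : ℕ)
    (p : Fin 3 → ZMod (2 * S + 1)) (j : Fin 3) :
    Continuous fun q : GaugeConfig 4 (2 * S + 1) G × (Site 4 (2 * S + 1) → G) =>
      froSq (cosMode r S p j q.1 q.2) := by
  unfold cosMode
  exact continuous_froSq_sum_smul_gluon r S j _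

/-- `froSq` of the sine mode is jointly continuous in `(U, h)`. [folklore] -/
theorem continuous_froSq_sinMode [IsTopologicalGroup G] (r : LatticeRep G) (S : ℕ)
    (p : Fin 3 → ZMod (2 * S + 1)) (j : Fin 3) :
    Continuous fun q : GaugeConfig 4 (2 * S + 1) G × (Site 4 (2 * S + 1) → G) =>
      froSq (sinMode r S p j q.1 q.2) := by
  unfold sinMode
  exact continuous_froSq_sum_smul_gluon r S j _

/-! #### Minimisers exist; the argmin graph is closed -/

/-- **Absolute Coulomb minimisers exist**: `Site → G` is compact and `coul(U, ·)` continuous.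
[folklore] -/
theorem exists_isCoulMin [IsTopologicalGroup G] [CompactSpace G] (r : LatticeRep G) (S : ℕ)
    (U : GaugeConfig 4 (2 * S + 1) G) : ∃ h, IsCoulMin r S U h :=
  exists_forall_le_of_continuous (continuous_coulombF r S) U

/-- The graph `{(U, h) | h ∈ argmin coul(U, ·)}` of the minimiser correspondence is closed.
[folklore] -/
theorem isClosed_isCoulMin [IsTopologicalGroup G] (r : LatticeRep G) (S : ℕ) :
    IsClosed {q : GaugeConfig 4 (2 * S + 1) G × (Site 4 (2 * S + 1) → G) |
      IsCoulMin r S q.1 q.2} :=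
  isClosed_setOf_forall_le (continuous_coulombF r S)

/-! #### A-priori bounds (unitarity of `ρ`) -/

/-- `froSq (A_j(y)) ≤ N`. [folklore] -/
theorem froSq_gluon_le (r : LatticeRep G) (S : ℕ) (U : GaugeConfig 4 (2 * S + 1) G)
    (h : Site 4 (2 * S + 1) → G) (y : Fin 3 → ZMod (2 * S + 1)) (j : Fin 3) :
    froSq (gluon r S U h y j) ≤ r.N := by
  unfold gluon
  exact (froSq_half_sub_conjTranspose_le _).trans
    (froSq_of_mem_unitaryGroup (r.mem_unitary _)).le

/-- The spatial slice has `(2S+1)³` sites. [folklore] -/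
theorem card_slice (S : ℕ) :
    (Fintype.card (Fin 3 → ZMod (2 * S + 1)) : ℝ) = (2 * S + 1 : ℝ) ^ 3 := by
  rw [Fintype.card_fun, ZMod.card, Fintype.card_fin]
  push_cast
  ring

/-- `froSq (Σ_y c_y • A_j(y)) ≤ N (2S+1)⁶` whenever `‖c_y‖ ≤ 1`. [folklore] -/
theorem froSq_sum_smul_gluon_le (r : LatticeRep G) (S : ℕ) (U : GaugeConfig 4 (2 * S + 1) G)
    (h : Site 4 (2 * S + 1) → G) (j : Fin 3) (c : (Fin 3 → ZMod (2 * S + 1)) → ℂ)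
    (hc : ∀ y, ‖c y‖ ≤ 1) :
    froSq (∑ y, c y • gluon r S U h y j) ≤ r.N * (2 * S + 1 : ℝ) ^ 6 := by
  calc froSq (∑ y, c y • gluon r S U h y j)
      ≤ ((Finset.univ : Finset (Fin 3 → ZMod (2 * S + 1))).card : ℝ) ^ 2 * r.N :=
        froSq_sum_smul_le _ c _ (fun y _ => hc y) (Nat.cast_nonneg _)
          (fun y _ => froSq_gluon_le r S U h y j)
    _ = r.N * (2 * S + 1 : ℝ) ^ 6 := by rw [Finset.card_univ, card_slice]; ring

/-- The plane-wave coefficients of `modeCov` are unimodular. [folklore] -/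
theorem norm_exp_coeff_le (S : ℕ) (p y : Fin 3 → ZMod (2 * S + 1)) :
    ‖Complex.exp (-(2 * Real.pi * Complex.I *
      (∑ i : Fin 3, ((p i).val : ℂ) * ((y i).val : ℂ)) / (2 * S + 1 : ℂ)))‖ ≤ 1 := by
  have : (-(2 * Real.pi * Complex.I *
      (∑ i : Fin 3, ((p i).val : ℂ) * ((y i).val : ℂ)) / (2 * S + 1 : ℂ))) =
      ((-(2 * Real.pi * (∑ i : Fin 3, ((p i).val : ℝ) * ((y i).val : ℝ)) / (2 * S + 1)) : ℝ) : ℂ) *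
        Complex.I := by
    push_cast
    ring
  rw [this, Complex.norm_exp_ofReal_mul_I]

/-- The cosine coefficients have norm `≤ 1`. [folklore] -/
theorem norm_real_cos_le (θ : ℝ) : ‖((Real.cos θ : ℝ) : ℂ)‖ ≤ 1 := by
  rw [Complex.norm_real, Real.norm_eq_abs]
  exact Real.abs_cos_le_one _

/-- The sine coefficients have norm `≤ 1`. [folklore] -/
theorem norm_real_sin_le (θ : ℝ) : ‖((Real.sin θ : ℝ) : ℂ)‖ ≤ 1 := by
  rw [Complex.norm_real, Real.norm_eq_abs]
  exact Real.abs_sin_le_one _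

/-- `0 ≤ modeCov`. [folklore] -/
theorem modeCov_nonneg (r : LatticeRep G) (S : ℕ) (U : GaugeConfig 4 (2 * S + 1) G)
    (h : Site 4 (2 * S + 1) → G) (p : Fin 3 → ZMod (2 * S + 1)) : 0 ≤ modeCov r S U h p := by
  unfold modeCov
  exact div_nonneg (Finset.sum_nonneg fun j _ => froSq_nonneg _) (by positivity)

/-- `modeCov ≤ 3 N (2S+1)³`. [folklore] -/
theorem modeCov_le (r : LatticeRep G) (S : ℕ) (U : GaugeConfig 4 (2 * S + 1) G)
    (h : Site 4 (2 * S + 1) → G) (p : Fin 3 → ZMod (2 * S + 1)) :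
    modeCov r S U h p ≤ 3 * r.N * (2 * S + 1 : ℝ) ^ 3 := by
  unfold modeCov
  rw [div_le_iff₀ (by positivity)]
  refine (Finset.sum_le_sum fun j _ =>
    froSq_sum_smul_gluon_le r S U h j _ (norm_exp_coeff_le S p)).trans (le_of_eq ?_)
  rw [Finset.sum_const, Finset.card_univ, Fintype.card_fin, nsmul_eq_mul]
  push_cast
  ring

/-- `froSq Ĉ_j(p) ≤ N (2S+1)⁶`. [folklore] -/
theorem froSq_cosMode_le (r : LatticeRep G) (S : ℕ) (p : Fin 3 → ZMod (2 * S + 1)) (j : Fin 3)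
    (U : GaugeConfig 4 (2 * S + 1) G) (h : Site 4 (2 * S + 1) → G) :
    froSq (cosMode r S p j U h) ≤ r.N * (2 * S + 1 : ℝ) ^ 6 := by
  unfold cosMode
  exact froSq_sum_smul_gluon_le r S U h j _ fun y => norm_real_cos_le _

/-- `froSq Ŝ_j(p) ≤ N (2S+1)⁶`. [folklore] -/
theorem froSq_sinMode_le (r : LatticeRep G) (S : ℕ) (p : Fin 3 → ZMod (2 * S + 1)) (j : Fin 3)
    (U : GaugeConfig 4 (2 * S + 1) G) (h : Site 4 (2 * S + 1) → G) :
    froSq (sinMode r S p j U h) ≤ r.N * (2 * S + 1 : ℝ) ^ 6 := by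
  unfold sinMode
  exact froSq_sum_smul_gluon_le r S U h j _ fun y => norm_real_sin_le _

end SupMeasurable

/-! ### The stub -/

open SupMeasurable in
/-- **Stub `stub_supMeasurable` (classical).** For a compact group `G` with a faithful continuous
unitary representation `r` (so `G` is second countable), on the torus `(2S+1)⁴`:
(1) every configuration `U` has an absolute minimiser of the slice Coulomb functional (compactness
of `Site → G`, continuity of `coul(U, ·)`); (2) `0 ≤ cov(U,h,p) ≤ 3N(2S+1)³` and
`‖Ĉ_j(p)‖²_F, ‖Ŝ_j(p)‖²_F ≤ N(2S+1)⁶` (unitarity: `‖ρ(g)‖²_F = N`, triangle inequality);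
(3) the sups over minimisers `supCov`, `supCosSq`, `supSinSq` are Borel measurable (Berge: the
argmin graph is closed, so the fibrewise sup of a jointly continuous function is upper
semicontinuous; Borel = product σ-algebra on the second-countable compact `G^{edges}`); (4) the same
bounds for the sups. [folklore] -/
theorem stub_supMeasurable :
    ∀ (G : Type) [Group G] [TopologicalSpace G] [IsTopologicalGroup G] [CompactSpace G]
    [MeasurableSpace G] [BorelSpace G] (r : LatticeRep G) (S : ℕ) (p : Fin 3 → ZMod (2 * S + 1))
    (j : Fin 3),
    (∀ U : GaugeConfig 4 (2 * S + 1) G, ∃ h, IsCoulMin r S U h) ∧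
    (∀ (U : GaugeConfig 4 (2 * S + 1) G) (h : Site 4 (2 * S + 1) → G),
      (0 ≤ modeCov r S U h p ∧ modeCov r S U h p ≤ 3 * r.N * (2 * S + 1 : ℝ) ^ 3) ∧
      froSq (cosMode r S p j U h) ≤ r.N * (2 * S + 1 : ℝ) ^ 6 ∧
      froSq (sinMode r S p j U h) ≤ r.N * (2 * S + 1 : ℝ) ^ 6) ∧
    Measurable (supCov r S p) ∧ Measurable (supCosSq r S p j) ∧ Measurable (supSinSq r S p j) ∧
    (∀ U : GaugeConfig 4 (2 * S + 1) G,
      (0 ≤ supCov r S p U ∧ supCov r S p U ≤ 3 * r.N * (2 * S + 1 : ℝ) ^ 3) ∧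
      (0 ≤ supCosSq r S p j U ∧ supCosSq r S p j U ≤ r.N * (2 * S + 1 : ℝ) ^ 6) ∧
      (0 ≤ supSinSq r S p j U ∧ supSinSq r S p j U ≤ r.N * (2 * S + 1 : ℝ) ^ 6)) := by
  intro G _ _ _ _ _ _ r S p j
  haveI : SecondCountableTopology G :=
    (r.continuous.isClosedEmbedding r.injective).isEmbedding.secondCountableTopology
  refine ⟨exists_isCoulMin r S, fun U h => ⟨⟨modeCov_nonneg r S U h p, modeCov_le r S U h p⟩,
    froSq_cosMode_le r S p j U h, froSq_sinMode_le r S p j U h⟩, ?_, ?_, ?_,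
    fun U => ⟨⟨?_, ?_⟩, ⟨?_, ?_⟩, ⟨?_, ?_⟩⟩⟩
  · exact measurable_iSup_subtype_of_isClosed (K := IsCoulMin r S)
      (f := fun U h => modeCov r S U h p) (isClosed_isCoulMin r S) (exists_isCoulMin r S)
      (continuous_modeCov r S p) (fun U h => modeCov_le r S U h p)
  · exact measurable_iSup_subtype_of_isClosed (K := IsCoulMin r S)
      (f := fun U h => froSq (cosMode r S p j U h)) (isClosed_isCoulMin r S)
      (exists_isCoulMin r S) (continuous_froSq_cosMode r S p j)
      (fun U h => froSq_cosMode_le r S p j U h)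
  · exact measurable_iSup_subtype_of_isClosed (K := IsCoulMin r S)
      (f := fun U h => froSq (sinMode r S p j U h)) (isClosed_isCoulMin r S)
      (exists_isCoulMin r S) (continuous_froSq_sinMode r S p j)
      (fun U h => froSq_sinMode_le r S p j U h)
  · exact Real.iSup_nonneg fun h => modeCov_nonneg r S U h.1 p
  · exact Real.iSup_le (fun h => modeCov_le r S U h.1 p) (by positivity)
  · exact Real.iSup_nonneg fun h => froSq_nonneg _
  · exact Real.iSup_le (fun h => froSq_cosMode_le r S p j U h.1) (by positivity)
  · exact Real.iSup_nonneg fun h => froSq_nonneg _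
  · exact Real.iSup_le (fun h => froSq_sinMode_le r S p j U h.1) (by positivity)

end Summit.QuantumFields.YangMills.Cruxes.CovarianceBound.SupportWindow

end
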